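import Summits.Ventures.CertifiedArithmetic.LowPrec.SRTreeEnvelopes
import Mathlib.Tactic.IntervalCases
import HarnessLib

/-!
# Summation order as a design variable, I: the shape statistic `sizeSq` and its minimiser

HONEST FRAMING (venture CertifiedArithmetic / cell `pub-lowprec`): certified error envelopes and
provably optimal rounding/accumulation schemes for low-precision formats under stated cost models;
every table by two implementations; no hardware or vendor claims.

COST MODEL (stated). Under a spacing law, the SR variance of a summation tree `T` is bounded through
`sqNodes T = ∑_{nodes v} (partial sum at v)²` (`SRSecondMoment.treeVar_le_secondMoment`). For EQUAL
summands `a` this is `a² · sizeSq T` with the pure SHAPE statistic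

  `sizeSq T = ∑_{internal nodes v} (number of leaves below v)²`,

so among all evaluation orders of `n` equal (or equal-magnitude-scale) summands the variance bound
is minimised by the tree minimising `sizeSq`. This file settles that discrete optimisation exactly:

* `optSq n` — the recursion `optSq n = n² + optSq ⌊n/2⌋ + optSq ⌈n/2⌉` (`optSq 0 = optSq 1 = 0`);
* `optSq_convex` — midpoint convexity (via the increment recursions `optSq_succ_sub_*`), hence the
  BALANCING INEQUALITY `optSq_balance : optSq ⌊(i+j)/2⌋ + optSq ⌈(i+j)/2⌉ ≤ optSq i + optSq j`;
* `optSq_le_sizeSq` — **lower bound for EVERY tree**: `optSq (leaves T) ≤ sizeSq T`;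
* `sizeSq_pairwise` — the pairwise (balanced halving) tree ATTAINS it: `sizeSq (pairwise x o n) =
  optSq n`; so `optSq` is the exact minimum and pairwise summation is an optimal order in this
  model (ties exist; e.g. every tree whose sibling leaf counts differ by ≤ 1 at every node);
* closed forms: `optSq_two_pow` (`optSq 2^k = 2·4^k − 2^(k+1)`, i.e. `2n² − 2n`), the general
  bound `optSq_le : optSq n + n + 1 ≤ 2n²` (`n ≥ 1`), and the left comb (recursive summation)
  `sizeSq_comb : 6·sizeSq (comb x s n) + 6 = (n+1)(n+2)(2n+3)` (`∼ n³/3`): recursive summation is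
  worse than pairwise by the factor `∼ n/6` in this statistic.

For WEIGHTED leaves (`sqNodes` itself) the greedy merge-two-smallest rule (Huffman; optimal for
the weighted path length, i.e. LINEAR node costs — conditions for its optimality under other cost
functions: [cite: Parker1980]) is NOT optimal for squared node sums: `huffman_not_optimal_sqSum`
(leaves `1,1,2,2`: greedy `56`, optimum `54`). Data-dependent bounds on `sqNodes` for nonnegative
summands follow in `SRTreeDesignData.lean`. Pairwise summation: [cite: Higham2002ASNA, §4.1].
-/

namespace Summit.Ventures.CertifiedArithmetic.LowPrec.SR

open Finset STree

/-! ### The shape statistic and the candidate optimum -/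

/-- `sizeSq T = ∑_{internal nodes} (leaves below the node)²`. -/
def sizeSq {K : Type*} : STree K → ℕ
  | .leaf _ => 0
  | .node l r => sizeSq l + sizeSq r + (l.leaves + r.leaves) ^ 2

/-- The optimum: `optSq 0 = optSq 1 = 0`, `optSq n = n² + optSq ⌊n/2⌋ + optSq ⌈n/2⌉` (`n ≥ 2`). -/
def optSq : ℕ → ℕ
  | 0 => 0
  | 1 => 0
  | n + 2 => (n + 2) ^ 2 + optSq ((n + 2) / 2) + optSq ((n + 3) / 2)
decreasing_by all_goals omega

/-- PAIRWISE SUMMATION of `x o, …, x (o + n − 1)` as a tree: halve (`⌊n/2⌋` left, `⌈n/2⌉` right)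
and recurse; `n ≤ 1` is the single leaf `x o`. [cite: Higham2002ASNA, §4.1] -/
def pairwise {K : Type*} (x : ℕ → K) : ℕ → ℕ → STree K
  | o, 0 => .leaf (x o)
  | o, 1 => .leaf (x o)
  | o, n + 2 => .node (pairwise x o ((n + 2) / 2)) (pairwise x (o + (n + 2) / 2) ((n + 3) / 2))
decreasing_by all_goals omega

/-- The defining equation of `optSq` for `n ≥ 2`. -/
theorem optSq_eq {n : ℕ} (hn : 2 ≤ n) : optSq n = n ^ 2 + optSq (n / 2) + optSq ((n + 1) / 2) := by
  obtain ⟨m, rfl⟩ : ∃ m, n = m + 2 := ⟨n - 2, by omega⟩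
  rw [optSq]

/-- Small values: `optSq 0 … optSq 8 = 0, 0, 4, 13, 24, 42, 62, 86, 112`. -/
theorem optSq_values : optSq 0 = 0 ∧ optSq 1 = 0 ∧ optSq 2 = 4 ∧ optSq 3 = 13 ∧ optSq 4 = 24 ∧
    optSq 5 = 42 ∧ optSq 6 = 62 ∧ optSq 7 = 86 ∧ optSq 8 = 112 := by simp [optSq]

/-- Even arguments: `optSq (2m) = 4m² + 2·optSq m` (`m ≥ 1`). -/
theorem optSq_two_mul {m : ℕ} (hm : 1 ≤ m) : optSq (2 * m) = (2 * m) ^ 2 + 2 * optSq m := by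
  rw [optSq_eq (by omega)]
  have h1 : 2 * m / 2 = m := by omega
  have h2 : (2 * m + 1) / 2 = m := by omega
  rw [h1, h2]; ring

/-- Odd arguments: `optSq (2m+1) = (2m+1)² + optSq m + optSq (m+1)` (`m ≥ 1`). -/
theorem optSq_two_mul_add_one {m : ℕ} (hm : 1 ≤ m) :
    optSq (2 * m + 1) = (2 * m + 1) ^ 2 + optSq m + optSq (m + 1) := by
  rw [optSq_eq (by omega)]
  have h1 : (2 * m + 1) / 2 = m := by omega
  have h2 : (2 * m + 1 + 1) / 2 = m + 1 := by omega
  rw [h1, h2]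

/-! ### Convexity of `optSq` (increments in `ℤ`) -/

/-- The increment `D k = optSq (k+1) − optSq k` as an integer. -/
def optSqInc (k : ℕ) : ℤ := (optSq (k + 1) : ℤ) - optSq k

/-- `D (2m) = 4m + 1 + D m` (`m ≥ 1`). -/
theorem optSqInc_two_mul {m : ℕ} (hm : 1 ≤ m) : optSqInc (2 * m) = 4 * m + 1 + optSqInc m := by
  unfold optSqInc
  rw [optSq_two_mul_add_one hm, optSq_two_mul hm]
  push_cast; ring

/-- `D (2m+1) = 4m + 3 + D m` (`m ≥ 1`). -/
theorem optSqInc_two_mul_add_one {m : ℕ} (hm : 1 ≤ m) :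
    optSqInc (2 * m + 1) = 4 * m + 3 + optSqInc m := by
  unfold optSqInc
  have h : 2 * m + 1 + 1 = 2 * (m + 1) := by ring
  rw [h, optSq_two_mul (by omega), optSq_two_mul_add_one hm]
  push_cast; ring

/-- The increments are nondecreasing: `D n ≤ D (n+1)`. -/
theorem optSqInc_le_succ : ∀ n : ℕ, optSqInc n ≤ optSqInc (n + 1) := by
  intro n
  induction n using Nat.strong_induction_on with
  | _ n ih =>
    rcases Nat.lt_or_ge n 2 with hn | hn
    · unfold optSqInc
      interval_cases n <;> simp [optSq]
    · obtain ⟨m, rfl | rfl⟩ : ∃ m, n = 2 * m ∨ n = 2 * m + 1 := ⟨n / 2, by omega⟩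
      · rw [optSqInc_two_mul (by omega), optSqInc_two_mul_add_one (by omega)]; omega
      · have h : 2 * m + 1 + 1 = 2 * (m + 1) := by ring
        rw [optSqInc_two_mul_add_one (by omega), h, optSqInc_two_mul (by omega)]
        have := ih m (by omega)
        push_cast; omega

/-- Monotonicity of the increments. -/
theorem optSqInc_mono : Monotone optSqInc := monotone_nat_of_le_succ optSqInc_le_succ

/-- **Midpoint convexity**: `2·optSq (n+1) ≤ optSq n + optSq (n+2)`. -/
theorem optSq_convex (n : ℕ) : 2 * optSq (n + 1) ≤ optSq n + optSq (n + 2) := by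
  have h := optSqInc_le_succ n
  unfold optSqInc at h
  rw [show n + 1 + 1 = n + 2 from rfl] at h
  omega

/-- Exchange step: moving one leaf from the larger to the smaller side does not increase the cost:
`optSq (i+1) + optSq j ≤ optSq i + optSq (j+1)` for `i ≤ j`. -/
theorem optSq_exchange {i j : ℕ} (hij : i ≤ j) :
    optSq (i + 1) + optSq j ≤ optSq i + optSq (j + 1) := by
  have h := optSqInc_mono hij
  unfold optSqInc at h
  omega

/-- **Balancing inequality**: the balanced split minimises `optSq i + optSq j` over `i + j = n`:
`optSq (n/2) + optSq ((n+1)/2) ≤ optSq i + optSq j` whenever `i + j = n`. -/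
theorem optSq_balance : ∀ (d i j : ℕ), j = i + d →
    optSq ((i + j) / 2) + optSq ((i + j + 1) / 2) ≤ optSq i + optSq j := by
  intro d
  induction d using Nat.strong_induction_on with
  | _ d ih =>
    intro i j hj
    rcases Nat.lt_or_ge d 2 with hd | hd
    · have e1 : (i + j) / 2 = i := by omega
      have e2 : (i + j + 1) / 2 = j := by omega
      rw [e1, e2]
    · -- shrink the gap by 2: (i, j) → (i+1, j-1)
      have h := ih (d - 2) (by omega) (i + 1) (j - 1) (by omega)
      have e1 : (i + 1 + (j - 1)) / 2 = (i + j) / 2 := by omega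
      have e2 : (i + 1 + (j - 1) + 1) / 2 = (i + j + 1) / 2 := by omega
      rw [e1, e2] at h
      have hx := optSq_exchange (i := i) (j := j - 1) (by omega)
      have e3 : j - 1 + 1 = j := by omega
      rw [e3] at hx
      omega

/-! ### The lower bound for every tree, attained by pairwise summation -/

/-- Every tree has at least one leaf. -/
theorem leaves_pos {K : Type*} : ∀ t : STree K, 1 ≤ t.leaves
  | .leaf _ => le_rfl
  | .node l _ => le_add_right (leaves_pos l)

/-- **Lower bound (every evaluation order).** `optSq (leaves T) ≤ sizeSq T`. -/
theorem optSq_le_sizeSq {K : Type*} : ∀ t : STree K, optSq t.leaves ≤ sizeSq t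
  | .leaf _ => by simp [STree.leaves, sizeSq, optSq]
  | .node l r => by
      have hl := optSq_le_sizeSq l
      have hr := optSq_le_sizeSq r
      have h1 := leaves_pos l
      have h2 := leaves_pos r
      simp only [STree.leaves, sizeSq]
      rw [optSq_eq (by omega)]
      have hb := optSq_balance (l.leaves + r.leaves - 2 * min l.leaves r.leaves)
        (min l.leaves r.leaves) (max l.leaves r.leaves) (by omega)
      have e1 : min l.leaves r.leaves + max l.leaves r.leaves = l.leaves + r.leaves :=
        min_add_max _ _
      rw [e1] at hb
      have e2 : optSq (min l.leaves r.leaves) + optSq (max l.leaves r.leaves)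
          = optSq l.leaves + optSq r.leaves := by
        rcases le_total l.leaves r.leaves with h | h
        · rw [min_eq_left h, max_eq_right h]
        · rw [min_eq_right h, max_eq_left h, add_comm]
      omega

/-- The pairwise tree on `n ≥ 1` summands has `n` leaves. -/
theorem leaves_pairwise {K : Type*} (x : ℕ → K) : ∀ (n o : ℕ), 1 ≤ n →
    (pairwise x o n).leaves = n := by
  intro n
  induction n using Nat.strong_induction_on with
  | _ n ih =>
    intro o hn
    rcases Nat.lt_or_ge n 2 with h | h
    · obtain rfl : n = 1 := by omega
      simp [pairwise, STree.leaves]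
    · obtain ⟨m, rfl⟩ : ∃ m, n = m + 2 := ⟨n - 2, by omega⟩
      rw [pairwise, STree.leaves, ih ((m + 2) / 2) (by omega) _ (by omega),
        ih ((m + 3) / 2) (by omega) _ (by omega)]
      omega

/-- **Pairwise summation attains the bound**: `sizeSq (pairwise x o n) = optSq n` (`n ≥ 1`). -/
theorem sizeSq_pairwise {K : Type*} (x : ℕ → K) : ∀ (n o : ℕ), 1 ≤ n →
    sizeSq (pairwise x o n) = optSq n := by
  intro n
  induction n using Nat.strong_induction_on with
  | _ n ih =>
    intro o hn
    rcases Nat.lt_or_ge n 2 with h | h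
    · obtain rfl : n = 1 := by omega
      simp [pairwise, sizeSq, optSq]
    · obtain ⟨m, rfl⟩ : ∃ m, n = m + 2 := ⟨n - 2, by omega⟩
      rw [pairwise, sizeSq, ih ((m + 2) / 2) (by omega) _ (by omega),
        ih ((m + 3) / 2) (by omega) _ (by omega), leaves_pairwise x _ _ (by omega),
        leaves_pairwise x _ _ (by omega), optSq]
      have e : (m + 2) / 2 + (m + 3) / 2 = m + 2 := by omega
      rw [e]; ring

/-- **Optimality of pairwise summation for the shape statistic**: for every tree `T` with `n`
leaves, `sizeSq (pairwise x o n) ≤ sizeSq T`. -/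
theorem sizeSq_pairwise_le {K : Type*} (x : ℕ → K) (o : ℕ) (T : STree K) :
    sizeSq (pairwise x o T.leaves) ≤ sizeSq T := by
  rw [sizeSq_pairwise x _ _ (leaves_pos T)]; exact optSq_le_sizeSq T

/-- The exact sum of the pairwise tree is the block sum `∑_{i<n} x (o+i)` (`n ≥ 1`). -/
theorem exact_pairwise {K : Type*} [AddCommMonoid K] (x : ℕ → K) : ∀ (n o : ℕ), 1 ≤ n →
    (pairwise x o n).exact = ∑ i ∈ range n, x (o + i) := by
  intro n
  induction n using Nat.strong_induction_on with
  | _ n ih =>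
    intro o hn
    rcases Nat.lt_or_ge n 2 with h | h
    · obtain rfl : n = 1 := by omega
      simp [pairwise, STree.exact]
    · obtain ⟨m, rfl⟩ : ∃ m, n = m + 2 := ⟨n - 2, by omega⟩
      rw [pairwise, STree.exact, ih ((m + 2) / 2) (by omega) _ (by omega),
        ih ((m + 3) / 2) (by omega) _ (by omega)]
      have e : m + 2 = (m + 2) / 2 + (m + 3) / 2 := by omega
      conv_rhs => rw [e, sum_range_add]
      simp only [add_assoc]

/-! ### Closed forms -/

/-- Perfect trees: `optSq (2^k) = 2·4^k − 2^(k+1)` (`= 2n² − 2n`, `n = 2^k`). -/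
theorem optSq_two_pow (k : ℕ) : optSq (2 ^ k) + 2 ^ (k + 1) = 2 * 4 ^ k := by
  induction k with
  | zero => simp [optSq]
  | succ k ih =>
      rw [pow_succ, mul_comm, optSq_two_mul (Nat.one_le_two_pow)]
      have e4 : (4 : ℕ) ^ (k + 1) = 4 * 4 ^ k := by rw [pow_succ, mul_comm]
      have e2 : (2 : ℕ) ^ (k + 1 + 1) = 2 * 2 ^ (k + 1) := by rw [pow_succ, mul_comm]
      have e3 : (2 * 2 ^ k) ^ 2 = 4 * 4 ^ k := by
        rw [mul_pow, ← pow_mul, pow_mul' ]; norm_num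
      rw [e4, e2, e3]
      have e5 : (2 : ℕ) ^ (k + 1) = 2 * 2 ^ k := by rw [pow_succ, mul_comm]
      omega

/-- General size: `optSq n + n + 1 ≤ 2n²` for `n ≥ 1` (equality at `n = 2m+1` odd steps). -/
theorem optSq_le : ∀ n : ℕ, 1 ≤ n → optSq n + n + 1 ≤ 2 * n ^ 2 := by
  intro n
  induction n using Nat.strong_induction_on with
  | _ n ih =>
    intro hn
    rcases Nat.lt_or_ge n 2 with h | h
    · obtain rfl : n = 1 := by omega
      simp [optSq]
    · obtain ⟨m, rfl | rfl⟩ : ∃ m, n = 2 * m ∨ n = 2 * m + 1 := ⟨n / 2, by omega⟩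
      · rw [optSq_two_mul (by omega)]
        have := ih m (by omega) (by omega)
        nlinarith
      · rw [optSq_two_mul_add_one (by omega)]
        have h1 := ih m (by omega) (by omega)
        have h2 := ih (m + 1) (by omega) (by omega)
        nlinarith

/-- The left comb (recursive summation, `n+1` leaves): `6·sizeSq (comb x s n) + 6 =
(n+1)(n+2)(2n+3)`, i.e. `sizeSq = ∑_{j=2}^{n+1} j² ∼ n³/3`. -/
theorem sizeSq_comb {K : Type*} (x : ℕ → K) (s : K) : ∀ n : ℕ,
    6 * sizeSq (comb x s n) + 6 = (n + 1) * (n + 2) * (2 * n + 3)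
  | 0 => rfl
  | n + 1 => by
      have ih := sizeSq_comb x s n
      have hl : (comb x s n).leaves = n + 1 := by rw [← STree.nodes_add_one, nodes_comb]
      rw [comb, sizeSq, hl, STree.leaves, sizeSq]
      nlinarith [ih]

/-! ### Weighted leaves: the greedy (Huffman) merge is not optimal for `∑ (node sum)²` -/

/-- `sqSum T = ∑_{internal nodes} (node sum)²` over `ℕ`-valued leaves (the integer shadow of
`SRSecondMoment.sqNodes`, for the counterexample). -/
def sqSum : STree ℕ → ℕ
  | .leaf _ => 0
  | .node l r => sqSum l + sqSum r + (l.exact + r.exact) ^ 2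

/-- **Huffman is not optimal for squared node sums.** On the leaves `1, 1, 2, 2` the greedy
merge-two-smallest order `((1+1)+2)+2` costs `4 + 16 + 36 = 56`, the pairing `(1+2)+(1+2)` costs
`9 + 9 + 36 = 54` (contrast: for linear node costs greedy merging is optimal; [cite: Parker1980]
for the general theory). -/
theorem huffman_not_optimal_sqSum :
    sqSum (.node (.node (.node (.leaf 1) (.leaf 1)) (.leaf 2)) (.leaf 2)) = 56 ∧
    sqSum (.node (.node (.leaf 1) (.leaf 2)) (.node (.leaf 1) (.leaf 2))) = 54 := by decide

end Summit.Ventures.CertifiedArithmetic.LowPrec.SR
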